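import Summits.QuantumFields.QCD.Theses.SpectralDefectExtinction
import Literature.MathematicalPhysics.QuantumFieldTheory.QCDPhaseQuenched
import Literature.MathematicalPhysics.QuantumLattice.WilsonDiracAP
import Summits.QuantumFields.QCD.Theorems.HeatSlicedQuarksInterleavedFlowProperStubFineWeightAdmissibleRP

/-!
# Stub Θ `stub_seaWeightReflectionPositive` — reflection positivity of the honest all-antiperiodic
sea weight on the odd torus (crux stmt-QuantumFields-18064 `ExtinctionBuildsQCD`, line
`block-away-the-sign`, registered line lemma of Stub C's SeaAdmissible: the RP clause of `AdmAt`)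

For `β_k ≥ 0`, bare masses on the physical branch `m_f(k) > −1` and `S ≥ 1`, the signed real weight
`w(U) = exp(−β_k S_W(U)) · Re ∏_f det D_W^{AP}(U, m_f(k))` (`N_f` flavours of `r = 1` Wilson quarks
antiperiodic in ALL four directions, `Literature.MathematicalPhysics.QuantumLattice.wilsonDiracAP`)
is reflection positive for the tree's link time reflection `GaugeConfig.timeReflect` (`t ↦ 1 − t`;
on the odd torus `ℤ/(2S+1)` the link reflection at `0|1` and the site reflection at `t = S+1`) on
bounded measurable positive-time gauge observables `F` (`IsPositiveTimeObservable`, slices `1 … S`):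
`0 ≤ ∫ F(ΘU) F(U) w(U) ∏ dU_e`.

Proof: this is the landed fine-weight lemma `InterleavedFlowProper.OffsetLastFormatHandover.stubFW_rp`
of the HeatSlicedQuarks line (same weight, same node `HeavyThresholdYMBridge.RobustYangMillsRG` rev 3;
Osterwalder–Seiler split of the crossing links, conditioning on the shared slice, Lüscher's
transfer-matrix Gram form of `det D_AP` per flavour, Schur product over flavours), instantiated at
`β = β_k`, `m_f = m_crit(k) + a_k m_f / Z_m(k)`.

References: K. Osterwalder, E. Seiler, Ann. Phys. 110 (1978) 440, §§2–3; M. Lüscher, Commun. Math.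
Phys. 54 (1977) 283, §3; I. Montvay, G. Münster, *Quantum Fields on a Lattice* (1994), §4.2.3
(4.90)–(4.111), §4.2.4 (4.112)–(4.115); P. Menotti, A. Pelissetto, Commun. Math. Phys. 113 (1987) 369.
-/

noncomputable section

namespace Summit.QuantumFields.QCD.Cruxes.ExtinctionBuildsQCD.BlockAwayTheSign

open scoped BigOperators Topology Classical MeasureTheory Matrix
open Filter MeasureTheory Matrix
open Literature.MathematicalPhysics.QuantumLattice Literature.MathematicalPhysics.AQFT
  Literature.MathematicalPhysics.QuantumFieldTheory
open Summit.QuantumFields.QCD.Theses.SpectralDefectExtinction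
open Summit.QuantumFields.QCD.Theses

/-- **Stub Θ `stub_seaWeightReflectionPositive` — reflection positivity of the honest all-antiperiodic
gauge marginal (registered line lemma of Stub C's SeaAdmissible, the RP clause of `AdmAt`; classical:
Osterwalder–Seiler / Lüscher).** For `β_k ≥ 0`, masses on the physical branch and `S ≥ 1`: for every
bounded measurable positive-time gauge observable `F` (tree `IsPositiveTimeObservable`, times `1 … S`
w.r.t. the reflection `GaugeConfig.timeReflect`, `θ(t) = 1 − t`, which on the odd torus `ℤ/(2S+1)` is
the link reflection at `0|1` and the site reflection at `t = S+1`), `∫ F(θU) F(U) w(U) dU ≥ 0` for the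
honest all-antiperiodic `N_f`-flavour sea weight `w(U) = exp(−β_k S_W(U)) · Re ∏_f det D_W^{AP}(U, m_f(k))`.
It is the landed fine-weight lemma `stubFW_rp` of the HeatSlicedQuarks line (crux stmt-QuantumFields-18031)
at `β = β_k`, `m_f = m_crit(k) + a_k m_f / Z_m(k)`. [cite: OsterwalderSeiler1978, §§2–3] [cite: Luscher1977, §3]
[cite: MontvayMunster1994, §4.2.3 (4.90)–(4.111) and §4.2.4 (4.112)–(4.115)] [cite: MenottiPelissetto1987] -/
theorem stub_seaWeightReflectionPositive :
    ∀ {Nf : ℕ} (reg : QCDRegularisation Nf) (m : Fin Nf → ℝ) (k S : ℕ), 1 ≤ S → 0 ≤ reg.β k →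
      (∀ fl : Fin Nf, -1 < reg.mcrit k + reg.a k * m fl / reg.Zm k) →
      ∀ F : GaugeConfig 4 (2 * S + 1) SU3 → ℝ, Measurable F → (∃ C : ℝ, ∀ U, |F U| ≤ C) → IsPositiveTimeObservable F →
      0 ≤ ∫ (U : GaugeConfig 4 (2 * S + 1) SU3),
          F (GaugeConfig.timeReflect U) * F U *
          (Real.exp (-(reg.β k * wilsonAction (fundamentalRep (Fin 3)) U)) *
            (∏ fl : Fin Nf, fermionDet (Literature.MathematicalPhysics.QuantumLattice.wilsonDiracAP U (reg.mcrit k + reg.a k * m fl / reg.Zm k))).re)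
        ∂(Measure.pi fun _ : Edge 4 (2 * S + 1) => haarProbability SU3) := by
  intro Nf reg m k S hS hβ hm F hF hFb hFpos
  exact Summit.QuantumFields.QCD.Cruxes.InterleavedFlowProper.OffsetLastFormatHandover.stubFW_rp Nf (reg.β k)
    (fun fl => reg.mcrit k + reg.a k * m fl / reg.Zm k) hβ hm S hS F hF hFb hFpos

end Summit.QuantumFields.QCD.Cruxes.ExtinctionBuildsQCD.BlockAwayTheSign

end
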